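import Literature.NumberTheory.EllipticCurves.PastenValuationProductSemistableProofs
import Literature.NumberTheory.DiophantineGeometry.PastenValuationProductsProofs
import Literature.NumberTheory.DiophantineGeometry.ValuationProductEllipticManyPrimesProofs
import HarnessLib

/-!
# Pasten, Theorem 16.5 (= Thm 1.12 + its many-prime sharpening) as established by its printed proof

Topic `NumberTheory/EllipticCurves`; namespace `Literature.NumberTheory.EllipticCurves`.

H. Pasten, *Shimura curves and the abc conjecture*, J. Number Theory 254 (2024) 214–335
(= arXiv:1705.09251, held; arXiv numbering), §16.3 **Theorem 16.5** (held copy p. 50):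

> Let `ε > 0`. There is a number `K_ε > 0` depending only on `ε` such that the following holds:
> For every semi-stable elliptic curve `E` over `ℚ` we have `∏_{p∣N_E} v_p(Δ_E) < K_ε · N_E^{11/2+ε}`.
> If moreover `ε > 0` and `E` has at least `3 + 11/ε` places of bad reduction, then we have the
> stronger estimate `∏_{p∣N_E} v_p(Δ_E) < K_ε · N_E^{8/3+ε}`.

The named fact `Literature.NumberTheory.EllipticCurves.pasten_thm_1_12`
(`PastenValuationProduct.lean`) transcribes this verbatim, with "at least `3 + 11/ε` places" as
`3 + 11/ε ≤ #(N_E).primeFactors`.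

## The discrepancy between the printed statement and the printed proof

The printed proof of the second display (p. 50) writes `N = p_1 ⋯ p_n`; for `n` even it is
Theorem 16.4 (i) with `D = N`, `M = 1`; for `n` odd it applies Theorem 16.4 (i) to the `n` admissible
factorisations `M_j = p_j p_{j+1} p_{j+2}`, `D_j = N / M_j`, multiplies and takes `(n-3)`-rd roots:
`∏_{p∣N} v_p(Δ_E) < N^{(8/3+ε')·n/(n-3)} · N^{3/(n-3)}`, and concludes: "there is a sufficiently
small `ε' > 0` (only depending on `ε`) such that **for all integers `n > 11/ε + 3`** we have
`(8/3+ε')·n/(n-3) + 3/(n-3) < 8/3 + ε`, hence the result."  Indeed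
`(8/3+ε')·n/(n-3) + 3/(n-3) = 8/3 + 11/(n-3) + ε'·n/(n-3)`, which is `< 8/3 + ε` for some `ε' > 0`
iff `11/(n-3) < ε` iff `n > 3 + 11/ε`.  So the proof establishes the second display for curves with
MORE THAN `3 + 11/ε` bad places; at the boundary `n = 3 + 11/ε` (which is an integer exactly when
`ε = 11/m`, `m ∈ ℕ`) it yields only the exponent `8/3 + ε + ε'·n/(n-3)`.  The boundary is still
covered by the paper's theorems when `n` is even (`D = N`), when `n = 5` (the first display:
`8/3 + 11/2 > 11/2`), and when `n ∈ {7, 9, 11}` (Theorem 16.1 over the `D = N/p_i` as in the proof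
of Corollary 16.2 gives the exponent `(11/3)·n/(n-1) + ε''`, and `(11/3)·n/(n-1) < 8/3 + 11/(n-3)`
iff `3n² - 34n + 9 < 0` iff `n ≤ 11`); but for `ε = 11/m` with `m` EVEN and `m ≥ 10`, semi-stable
curves with exactly `m + 3` bad primes are claimed by the statement and not reached by any
combination of the printed bounds: if the `n = m + 3` bad primes have comparable size
(`log p_i ≈ (log N)/n`), the point `log v_p(Δ_E) / log N = (8/3 + 3/n)/(n-3)` for all `p`
satisfies every case of Theorem 16.1 (`Σ_{p∣D} ≤ 11/3`, `#D` even) and of Theorem 16.4 (i)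
(`Σ_{p∣D} ≤ 8/3 + log M / log N`, `M` not prime) and has `Σ_p = 8/3 + 11/(n-3) = 8/3 + ε` exactly.
(The same analysis is recorded independently in the module docstring of
`Literature/NumberTheory/DiophantineGeometry/ValuationProductEllipticManyPrimesProofs.lean`.)
Presumably the boundary statement is true (it would follow with room to spare from Szpiro's
conjecture), but it is not a theorem of the source, so the verbatim fact `pasten_thm_1_12` cannot be
discharged from the literature as it stands.

## Contents (theorems only; the corrected statement is spelled out, not minted as a named fact)

Write `S` for the CORRECTED statement — Theorem 16.5 with "more than `3 + 11/ε` places of bad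
reduction" (`3 + 11/ε < #(N_E).primeFactors`), the first display unchanged, one constant `K_ε` for
both displays, semi-stable = `W.IsSemistable ℤ` — i.e. exactly what the printed proof proves.  A
proving seat may not introduce a new unproved named fact (D-0026), so `S` is not named here;
it appears verbatim as the conclusion / side of the following theorems (a statement-level vendoring
of `S` as a named fact — suggested name `pasten_thm_1_12_strict`, same cite — is the recommended
replacement of the verbatim fact; its text can be read off `pasten_thm_1_12.strict`).

* `pasten_thm_1_12.strict` — the verbatim fact implies `S` ("at least" is stronger than "more than").
* `pasten_thm_1_12_strict_iff_pastenShimura2024` — `S` is the conjunction of the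
  `DiophantineGeometry` vendoring of the first display (`pastenShimura2024_thm_1_12`, semi-stable as
  `Squarefree N_E`) and the strict second display in the shape proved in
  `ValuationProductEllipticManyPrimesProofs.lean`.
* `pasten_thm_1_12_strict_of_thm_16_4` — **the printed proof of Theorem 16.5, assembled; `S` holds
  given the paper's cited inputs**: Corollary 16.2 (`pasten_cor_16_2`) and Mestre–Oesterlé for prime
  conductor (`mestreOesterle_factorization_le_five`) — both named facts of `PastenValuationProduct.lean` —
  and Theorem 16.4 (i) as an explicit hypothesis (not a fact of the tree, D-0026), using
  `pasten_valuationProduct_semistable_of_cor_16_2` (first display) and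
  `Literature.NumberTheory.DiophantineGeometry.pastenShimura2024_thm_16_5_manyPrimes_strict_of_thm_16_4`
  (second display).
* `pasten_thm_1_12_iff_strict_and_boundary` — the verbatim fact is EQUIVALENT to `S` plus the
  boundary family `B(m)`, `m ≥ 1`: "there is `K > 0` such that every semi-stable `E/ℚ` with exactly
  `m + 3` bad primes has `∏_{p∣N_E} v_p(Δ_E) < K · N_E^{8/3 + 11/m}`" — isolating precisely the
  residue discussed above.
* `prod_lt_of_thm_16_4_of_even`, `boundary_of_thm_16_1` (with the `(n-1)`-st-root step
  `prod_lt_rpow_of_forall_erase` of the proof of Corollary 16.2, sharp exponent) — what the paper's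
  Theorem 16.4 (i) and Theorem 16.1 (explicit hypotheses) give at the boundary: `B(m)` for `m` odd
  and for `m ∈ {2, 4, 6, 8}`.
* `pasten_thm_1_12_iff_boundary_even_ten_le` — given Corollary 16.2, Mestre–Oesterlé, Theorem 16.4 (i)
  and Theorem 16.1, the verbatim fact is equivalent to `B(m)` for `m` even `≥ 10`: exactly the part
  of the printed statement that nothing in the source addresses.

No `sorry`, no new axiom, no new definition.

## References

* [PastenShimura2024] H. Pasten, *Shimura curves and the abc conjecture*, J. Number Theory 254
  (2024) 214–335, doi:10.1016/j.jnt.2023.07.002, arXiv:1705.09251 — Theorem 1.12; §16.3 Theorem 16.5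
  and its proof (arXiv p. 50); §16.2 Theorem 16.4 (i); Corollary 16.2; Theorem 16.1.
* [MestreOesterle1989] J.-F. Mestre, J. Oesterlé, *Courbes de Weil semi-stables de discriminant une
  puissance m-ième*, J. reine angew. Math. 400 (1989) 173–184 — Thm 1.
-/

noncomputable section

open IsDedekindDomain

namespace Literature.NumberTheory.EllipticCurves

open Literature.NumberTheory.DiophantineGeometry

/-- `K · N^s` is monotone in the constant `K` (`N : ℕ`, real exponent `s`). [folklore] -/
private theorem const_mul_rpow_mono' {K K' : ℝ} (h : K ≤ K') (N : ℕ) (s : ℝ) :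
    K * (N : ℝ) ^ s ≤ K' * (N : ℝ) ^ s :=
  mul_le_mul_of_nonneg_right h (Real.rpow_nonneg (Nat.cast_nonneg N) s)

/-- **Pasten, Theorem 16.5 (= Thm 1.12 and its many-prime sharpening) as established by its
printed proof — the CORRECTED STATEMENT `S`, obtained here from the verbatim fact.**  For every
`ε > 0` there is `K_ε > 0` such that (i) every semi-stable elliptic curve `E/ℚ` has
`∏_{p∣N_E} v_p(Δ_E) < K_ε · N_E^{11/2+ε}`, and (ii) every semi-stable `E/ℚ` with MORE THAN
`3 + 11/ε` places of bad reduction has `∏_{p∣N_E} v_p(Δ_E) < K_ε · N_E^{8/3+ε}`.  The printed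
Theorem 16.5 (transcribed verbatim by `pasten_thm_1_12`) says "at least `3 + 11/ε` places", but its
printed proof (p. 50: "for all integers `n > 11/ε + 3`") covers only "more than", and the boundary
`n = 3 + 11/ε` with `n` odd `≥ 13` is not reached by the paper's bounds (module docstring); "at
least" trivially implies "more than".  `v_p(Δ_E) = (W.minimalDiscriminantNorm ℤ).factorization p`,
bad places = prime factors of `N_E = W.conductorNorm ℤ`, semi-stable = `W.IsSemistable ℤ`.
[cite: PastenShimura2024, Theorem 16.5 (arXiv numbering) with its proof, p. 50; Theorem 1.12] -/
theorem pasten_thm_1_12.strict (h : pasten_thm_1_12) :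
    ∀ ε : ℝ, 0 < ε → ∃ K : ℝ, 0 < K ∧
      (∀ (W : WeierstrassCurve ℚ) [W.IsElliptic], W.IsSemistable ℤ →
        ((∏ p ∈ (W.conductorNorm ℤ).primeFactors,
            (W.minimalDiscriminantNorm ℤ).factorization p : ℕ) : ℝ)
          < K * (W.conductorNorm ℤ : ℝ) ^ (11 / 2 + ε : ℝ)) ∧
      (∀ (W : WeierstrassCurve ℚ) [W.IsElliptic], W.IsSemistable ℤ →
        (3 : ℝ) + 11 / ε < ((W.conductorNorm ℤ).primeFactors.card : ℝ) →
        ((∏ p ∈ (W.conductorNorm ℤ).primeFactors,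
            (W.minimalDiscriminantNorm ℤ).factorization p : ℕ) : ℝ)
          < K * (W.conductorNorm ℤ : ℝ) ^ (8 / 3 + ε : ℝ)) := by
  intro ε hε
  obtain ⟨K, hK, h₁, h₂⟩ := h ε hε
  exact ⟨K, hK, fun W _ hW ↦ h₁ W hW, fun W _ hW hn ↦ h₂ W hW hn.le⟩

/-- **The corrected statement over `Squarefree N_E`.**  `S` is the conjunction of
`Literature.NumberTheory.DiophantineGeometry.pastenShimura2024_thm_1_12` (first display, semi-stable
as `Squarefree (W.conductorNorm ℤ)`) and the strict second display in the shape of the conclusion of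
`Literature.NumberTheory.DiophantineGeometry.pastenShimura2024_thm_16_5_manyPrimes_strict_of_thm_16_4`;
the dictionary is `WeierstrassCurve.isSemistable_iff_squarefree_conductorNorm` (Silverman ATAEC
IV.10.2, discharged), the common constant is `max K₁ K₂`.
[cite: PastenShimura2024, Theorem 1.12 and Theorem 16.5 (arXiv numbering)] -/
theorem pasten_thm_1_12_strict_iff_pastenShimura2024 :
    (∀ ε : ℝ, 0 < ε → ∃ K : ℝ, 0 < K ∧
      (∀ (W : WeierstrassCurve ℚ) [W.IsElliptic], W.IsSemistable ℤ →
        ((∏ p ∈ (W.conductorNorm ℤ).primeFactors,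
            (W.minimalDiscriminantNorm ℤ).factorization p : ℕ) : ℝ)
          < K * (W.conductorNorm ℤ : ℝ) ^ (11 / 2 + ε : ℝ)) ∧
      (∀ (W : WeierstrassCurve ℚ) [W.IsElliptic], W.IsSemistable ℤ →
        (3 : ℝ) + 11 / ε < ((W.conductorNorm ℤ).primeFactors.card : ℝ) →
        ((∏ p ∈ (W.conductorNorm ℤ).primeFactors,
            (W.minimalDiscriminantNorm ℤ).factorization p : ℕ) : ℝ)
          < K * (W.conductorNorm ℤ : ℝ) ^ (8 / 3 + ε : ℝ))) ↔
    pastenShimura2024_thm_1_12 ∧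
      (∀ ε : ℝ, 0 < ε → ∃ K : ℝ, 0 < K ∧ ∀ (W : WeierstrassCurve ℚ) [W.IsElliptic],
        Squarefree (W.conductorNorm ℤ) →
          (3 : ℝ) + 11 / ε < ((W.conductorNorm ℤ).primeFactors.card : ℝ) →
            ((∏ p ∈ (W.conductorNorm ℤ).primeFactors,
                (W.minimalDiscriminantNorm ℤ).factorization p : ℕ) : ℝ)
              < K * (W.conductorNorm ℤ : ℝ) ^ (8 / 3 + ε : ℝ)) := by
  constructor
  · intro h
    refine ⟨fun ε hε ↦ ?_, fun ε hε ↦ ?_⟩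
    · obtain ⟨K, hK, h₁, -⟩ := h ε hε
      exact ⟨K, hK, fun W _ hsq ↦ h₁ W ((W.isSemistable_iff_squarefree_conductorNorm).mpr hsq)⟩
    · obtain ⟨K, hK, -, h₂⟩ := h ε hε
      exact ⟨K, hK, fun W _ hsq hn ↦
        h₂ W ((W.isSemistable_iff_squarefree_conductorNorm).mpr hsq) hn⟩
  · rintro ⟨h₁, h₂⟩ ε hε
    obtain ⟨K₁, hK₁, h₁⟩ := h₁ ε hε
    obtain ⟨K₂, hK₂, h₂⟩ := h₂ ε hε
    refine ⟨max K₁ K₂, lt_max_of_lt_left hK₁, fun W _ hW ↦ ?_, fun W _ hW hn ↦ ?_⟩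
    · exact (h₁ W ((W.isSemistable_iff_squarefree_conductorNorm).mp hW)).trans_le
        (const_mul_rpow_mono' (le_max_left K₁ K₂) _ _)
    · exact (h₂ W ((W.isSemistable_iff_squarefree_conductorNorm).mp hW) hn).trans_le
        (const_mul_rpow_mono' (le_max_right K₁ K₂) _ _)

/-- **The printed proof of Theorem 16.5, assembled.**  Inputs, exactly as cited in print: Corollary
16.2 (`pasten_cor_16_2`, used with `S = ∅`) and "if `N_E = p` is prime then `v_p(Δ_E) ≤ 5`
(cf. [MestreOesterle])" (`mestreOesterle_factorization_le_five`) give the first display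
(`pasten_valuationProduct_semistable_of_cor_16_2`); Theorem 16.4 (i) — hypothesis `h164`, stated
for squarefree conductors `N ≥ N₀(ε)` and admissible `N = DM` (`1 < D ∣ N` with an even number of
prime factors, `M = N/D` not prime): `∏_{p∣D} v_p(Δ_E) < N^{8/3+ε} · M`; an explicit hypothesis,
NOT a fact of the tree — gives the second display for more than `3 + 11/ε` bad places
(`pastenShimura2024_thm_16_5_manyPrimes_strict_of_thm_16_4`, which absorbs the conductors `< N₀`
with the first display).  Hence, once `pasten_cor_16_2`, `mestreOesterle_factorization_le_five` and
Theorem 16.4 (i) are available, the corrected statement `S` holds.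
[cite: PastenShimura2024, Theorem 16.5 (arXiv numbering), proof, p. 50] -/
theorem pasten_thm_1_12_strict_of_thm_16_4 (h₁ : pasten_cor_16_2)
    (h₂ : mestreOesterle_factorization_le_five)
    (h164 : ∀ ε : ℝ, 0 < ε → ∃ N₀ : ℕ, ∀ (W : WeierstrassCurve ℚ) [W.IsElliptic],
      Squarefree (W.conductorNorm ℤ) → N₀ ≤ W.conductorNorm ℤ →
        ∀ D : ℕ, 1 < D → D ∣ W.conductorNorm ℤ → Even D.primeFactors.card →
          ¬ (W.conductorNorm ℤ / D).Prime →
            ((∏ p ∈ D.primeFactors, (W.minimalDiscriminantNorm ℤ).factorization p : ℕ) : ℝ)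
              < (W.conductorNorm ℤ : ℝ) ^ (8 / 3 + ε : ℝ) * ((W.conductorNorm ℤ / D : ℕ) : ℝ)) :
    ∀ ε : ℝ, 0 < ε → ∃ K : ℝ, 0 < K ∧
      (∀ (W : WeierstrassCurve ℚ) [W.IsElliptic], W.IsSemistable ℤ →
        ((∏ p ∈ (W.conductorNorm ℤ).primeFactors,
            (W.minimalDiscriminantNorm ℤ).factorization p : ℕ) : ℝ)
          < K * (W.conductorNorm ℤ : ℝ) ^ (11 / 2 + ε : ℝ)) ∧
      (∀ (W : WeierstrassCurve ℚ) [W.IsElliptic], W.IsSemistable ℤ →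
        (3 : ℝ) + 11 / ε < ((W.conductorNorm ℤ).primeFactors.card : ℝ) →
        ((∏ p ∈ (W.conductorNorm ℤ).primeFactors,
            (W.minimalDiscriminantNorm ℤ).factorization p : ℕ) : ℝ)
          < K * (W.conductorNorm ℤ : ℝ) ^ (8 / 3 + ε : ℝ)) := by
  have h112 : pastenShimura2024_thm_1_12 :=
    pasten_valuationProduct_semistable_iff_pastenShimura2024_thm_1_12.mp
      (pasten_valuationProduct_semistable_of_cor_16_2 h₁ h₂)
  exact pasten_thm_1_12_strict_iff_pastenShimura2024.mpr
    ⟨h112, pastenShimura2024_thm_16_5_manyPrimes_strict_of_thm_16_4 h112 h164⟩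

/-- **What separates the verbatim fact from the corrected statement.**  `pasten_thm_1_12` is
equivalent to `S` together with the boundary family: for every integer `m ≥ 1` there is
`K > 0` such that every semi-stable `E/ℚ` with exactly `m + 3` places of bad reduction has
`∏_{p∣N_E} v_p(Δ_E) < K · N_E^{8/3 + 11/m}` (the case `ε = 11/m`, `n = 3 + 11/ε` of the printed
statement).  (`→`: specialise the verbatim fact at `ε = 11/m`.  `←`: given `ε`, if `11/ε = m ∈ ℕ`
take `max K₁ K₂` and split `n ≥ 3 + 11/ε` into `n > 3 + 11/ε` (strict part) and `n = m + 3`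
(boundary part); if `11/ε ∉ ℕ`, "at least" and "more than" coincide.)  The paper's arguments
cover the boundary family only for `m` odd (`n = m + 3` even: Theorem 16.4 (i) with `D = N`),
`m = 2` (first display) and `m ∈ {4, 6, 8}` (Theorem 16.1) — see the module docstring.
[cite: PastenShimura2024, Theorem 16.5 (arXiv numbering) and its proof, p. 50] -/
theorem pasten_thm_1_12_iff_strict_and_boundary :
    pasten_thm_1_12 ↔
    (∀ ε : ℝ, 0 < ε → ∃ K : ℝ, 0 < K ∧
      (∀ (W : WeierstrassCurve ℚ) [W.IsElliptic], W.IsSemistable ℤ →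
        ((∏ p ∈ (W.conductorNorm ℤ).primeFactors,
            (W.minimalDiscriminantNorm ℤ).factorization p : ℕ) : ℝ)
          < K * (W.conductorNorm ℤ : ℝ) ^ (11 / 2 + ε : ℝ)) ∧
      (∀ (W : WeierstrassCurve ℚ) [W.IsElliptic], W.IsSemistable ℤ →
        (3 : ℝ) + 11 / ε < ((W.conductorNorm ℤ).primeFactors.card : ℝ) →
        ((∏ p ∈ (W.conductorNorm ℤ).primeFactors,
            (W.minimalDiscriminantNorm ℤ).factorization p : ℕ) : ℝ)
          < K * (W.conductorNorm ℤ : ℝ) ^ (8 / 3 + ε : ℝ))) ∧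
      (∀ m : ℕ, 0 < m → ∃ K : ℝ, 0 < K ∧ ∀ (W : WeierstrassCurve ℚ) [W.IsElliptic],
        W.IsSemistable ℤ → (W.conductorNorm ℤ).primeFactors.card = m + 3 →
          ((∏ p ∈ (W.conductorNorm ℤ).primeFactors,
              (W.minimalDiscriminantNorm ℤ).factorization p : ℕ) : ℝ)
            < K * (W.conductorNorm ℤ : ℝ) ^ (8 / 3 + 11 / m : ℝ)) := by
  constructor
  · intro h
    refine ⟨pasten_thm_1_12.strict h, fun m hm ↦ ?_⟩
    have hm0 : (m : ℝ) ≠ 0 := by exact_mod_cast hm.ne'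
    obtain ⟨K, hK, -, h₂⟩ := h (11 / m) (by positivity)
    refine ⟨K, hK, fun W _ hW hcard ↦ h₂ W hW (le_of_eq ?_)⟩
    rw [hcard, div_div_cancel₀ (by norm_num : (11 : ℝ) ≠ 0)]
    push_cast
    ring
  · rintro ⟨hs, hb⟩ ε hε
    obtain ⟨K₁, hK₁, h₁, h₂⟩ := hs ε hε
    by_cases hnat : ∃ m : ℕ, (11 : ℝ) / ε = m
    · obtain ⟨m, hm⟩ := hnat
      have hmpos : 0 < m := by
        have h0 : (0 : ℝ) < m := hm ▸ by positivity
        exact_mod_cast h0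
      obtain ⟨K₂, hK₂, h₃⟩ := hb m hmpos
      refine ⟨max K₁ K₂, lt_max_of_lt_left hK₁,
        fun W _ hW ↦ (h₁ W hW).trans_le (const_mul_rpow_mono' (le_max_left K₁ K₂) _ _),
        fun W _ hW hn ↦ ?_⟩
      rcases hn.lt_or_eq with hlt | heq
      · exact (h₂ W hW hlt).trans_le (const_mul_rpow_mono' (le_max_left K₁ K₂) _ _)
      · have hcard : (W.conductorNorm ℤ).primeFactors.card = m + 3 := by
          have h' : (((W.conductorNorm ℤ).primeFactors.card : ℕ) : ℝ) = (m : ℝ) + 3 := by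
            rw [← heq, hm]; ring
          exact_mod_cast h'
        have h11m : (11 : ℝ) / m = ε := by
          rw [← hm, div_div_cancel₀ (by norm_num : (11 : ℝ) ≠ 0)]
        have h₄ := h₃ W hW hcard
        rw [h11m] at h₄
        exact h₄.trans_le (const_mul_rpow_mono' (le_max_right K₁ K₂) _ _)
    · push Not at hnat
      refine ⟨K₁, hK₁, h₁, fun W _ hW hn ↦ h₂ W hW (lt_of_le_of_ne hn fun heq ↦ ?_)⟩
      have h3 : 3 ≤ (W.conductorNorm ℤ).primeFactors.card := by
        exact_mod_cast (show (3 : ℝ) ≤ (W.conductorNorm ℤ).primeFactors.card by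
          linarith [show (0 : ℝ) < 11 / ε by positivity])
      refine hnat ((W.conductorNorm ℤ).primeFactors.card - 3) ?_
      push_cast [h3]
      linarith

/-! ### What the paper's theorems give at the boundary `n = 3 + 11/ε`

With Theorem 16.4 (i) (`h164`) and Theorem 16.1 (`h161`; semi-stable case, `S = ∅`) as explicit
hypotheses — in the shapes used in `ValuationProductEllipticManyPrimesProofs.lean`: squarefree
conductor `N ≥ N₀(ε)`, divisors `1 < D ∣ N` with an even number of prime factors — and the first
display for the finitely many small conductors, the boundary family `B(m)` of
`pasten_thm_1_12_iff_strict_and_boundary` holds for `m` odd (`n = m + 3` even: `D = N`, `M = 1`,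
`prod_lt_of_thm_16_4_of_even`) and for `m ∈ {2, 4, 6, 8}` (`n ∈ {5, 7, 9, 11}`: Theorem 16.1 for the
`n` divisors `D = N/p_i` and `(n-1)`-st roots as in the printed proof of Corollary 16.2, exponent
`(11/3 + ε')·n/(n-1) ≤ 8/3 + 11/m` for `ε' = 1/150`, `boundary_of_thm_16_1`).  Hence, given every
theorem-level input of the paper, the verbatim fact `pasten_thm_1_12` is EQUIVALENT to `B(m)` for
`m` even `≥ 10` (`pasten_thm_1_12_iff_boundary_even_ten_le`) — the residue left open by the source. -/

section Boundary

open Finset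

/-- **`n` even: Theorem 16.4 (i) with `D = N`, `M = 1`** ("If `n` is even then the bound follows
from case (i) of Theorem 16.4 with `D = N` and `M = 1`", p. 50): for EVERY `ε > 0` there is `K`
such that every semi-stable `E/ℚ` with an even number of places of bad reduction has
`∏_{p∣N_E} v_p(Δ_E) < K · N_E^{8/3+ε}` — in this case no lower bound on the number of bad places is
needed.  Conductors `< N₀(ε)` are absorbed with the first display (`h112`, exponent `11/2 + 1`);
`K = max (K₁ N₀^{13/2}) 2` (`N_E = 1` gives the empty product `1 < 2`).
[cite: PastenShimura2024, Theorem 16.5 (arXiv numbering), proof (even case), p. 50] -/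
theorem prod_lt_of_thm_16_4_of_even (h112 : pastenShimura2024_thm_1_12)
    (h164 : ∀ ε : ℝ, 0 < ε → ∃ N₀ : ℕ, ∀ (W : WeierstrassCurve ℚ) [W.IsElliptic],
      Squarefree (W.conductorNorm ℤ) → N₀ ≤ W.conductorNorm ℤ →
        ∀ D : ℕ, 1 < D → D ∣ W.conductorNorm ℤ → Even D.primeFactors.card →
          ¬ (W.conductorNorm ℤ / D).Prime →
            ((∏ p ∈ D.primeFactors, (W.minimalDiscriminantNorm ℤ).factorization p : ℕ) : ℝ)
              < (W.conductorNorm ℤ : ℝ) ^ (8 / 3 + ε : ℝ) * ((W.conductorNorm ℤ / D : ℕ) : ℝ)) :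
    ∀ ε : ℝ, 0 < ε → ∃ K : ℝ, 0 < K ∧ ∀ (W : WeierstrassCurve ℚ) [W.IsElliptic],
      Squarefree (W.conductorNorm ℤ) → Even (W.conductorNorm ℤ).primeFactors.card →
        ((∏ p ∈ (W.conductorNorm ℤ).primeFactors,
            (W.minimalDiscriminantNorm ℤ).factorization p : ℕ) : ℝ)
          < K * (W.conductorNorm ℤ : ℝ) ^ (8 / 3 + ε : ℝ) := by
  intro ε hε
  obtain ⟨N₀, hN₀⟩ := h164 ε hε
  obtain ⟨K₁, hK₁pos, hK₁⟩ := h112 1 one_pos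
  have hKpos : (0 : ℝ) < max (K₁ * (N₀ : ℝ) ^ (11 / 2 + 1 : ℝ)) 2 := lt_max_of_lt_right two_pos
  refine ⟨max (K₁ * (N₀ : ℝ) ^ (11 / 2 + 1 : ℝ)) 2, hKpos, fun W _ hsq heven ↦ ?_⟩
  -- Generalise the conductor and the minimal discriminant norm of `W` to plain naturals `N`, `Δ`.
  obtain ⟨N, hN⟩ : ∃ N : ℕ, W.conductorNorm ℤ = N := ⟨_, rfl⟩
  obtain ⟨Δ, hΔ⟩ : ∃ Δ : ℕ, W.minimalDiscriminantNorm ℤ = Δ := ⟨_, rfl⟩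
  have H164 := hN₀ W hsq
  have H112 := hK₁ W hsq
  rw [hN, hΔ] at H164 H112
  rw [hN] at hsq heven
  rw [hN, hΔ]
  have hN0 : N ≠ 0 := hsq.ne_zero
  have hNpos : (0 : ℝ) < N := by exact_mod_cast Nat.pos_of_ne_zero hN0
  have hrpow_pos : 0 < (N : ℝ) ^ (8 / 3 + ε : ℝ) := Real.rpow_pos_of_pos hNpos _
  have hrpow_one : 1 ≤ (N : ℝ) ^ (8 / 3 + ε : ℝ) :=
    Real.one_le_rpow (by exact_mod_cast Nat.pos_of_ne_zero hN0) (by positivity)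
  by_cases hsmall : N < N₀
  · -- Small conductor: the first display with exponent `11/2 + 1`, a constant.
    calc ((∏ p ∈ N.primeFactors, Δ.factorization p : ℕ) : ℝ)
        < K₁ * (N : ℝ) ^ (11 / 2 + 1 : ℝ) := H112
      _ ≤ K₁ * (N₀ : ℝ) ^ (11 / 2 + 1 : ℝ) := mul_le_mul_of_nonneg_left
          (Real.rpow_le_rpow hNpos.le (by exact_mod_cast hsmall.le) (by norm_num)) hK₁pos.le
      _ ≤ max (K₁ * (N₀ : ℝ) ^ (11 / 2 + 1 : ℝ)) 2 := le_max_left _ _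
      _ ≤ max (K₁ * (N₀ : ℝ) ^ (11 / 2 + 1 : ℝ)) 2 * (N : ℝ) ^ (8 / 3 + ε : ℝ) :=
          le_mul_of_one_le_right hKpos.le hrpow_one
  · rw [not_lt] at hsmall
    rcases eq_or_ne N 1 with rfl | hN1
    · -- `N = 1`: no bad prime, empty product.
      simp only [Nat.primeFactors_one, prod_empty, Nat.cast_one, Real.one_rpow, mul_one]
      exact lt_max_of_lt_right one_lt_two
    · -- Large conductor: Theorem 16.4 (i) with `D = N`, `M = N/N = 1` (not a prime).
      have h1N : 1 < N := Nat.one_lt_iff_ne_zero_and_ne_one.2 ⟨hN0, hN1⟩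
      have hdiv : N / N = 1 := Nat.div_self (Nat.pos_of_ne_zero hN0)
      have h := H164 hsmall N h1N dvd_rfl heven (by rw [hdiv]; exact Nat.not_prime_one)
      rw [hdiv, Nat.cast_one, mul_one] at h
      exact h.trans_le (le_mul_of_one_le_left hrpow_pos.le (one_le_two.trans (le_max_right _ _)))

/-- `Σ_{q ∈ P} Σ_{p ∈ P, p ≠ q} f p = (#P - 1) · Σ_{p ∈ P} f p`. [folklore] -/
private theorem sum_sum_erase_eq (P : Finset ℕ) (f : ℕ → ℝ) :
    ∑ q ∈ P, ∑ p ∈ P.erase q, f p = ((P.card : ℝ) - 1) * ∑ p ∈ P, f p := by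
  rw [sum_congr rfl fun q hq ↦ sum_erase_eq_sub hq, sum_sub_distrib, sum_const, nsmul_eq_mul]
  ring

/-- **The `(n-1)`-st-root step** of the printed proof of Corollary 16.2 (p. 49: "`∏_{p∣N_E^*} v_p(Δ_E)
= (∏_{i=1}^n ∏_{p∣(N_E^*/p_i)} v_p(Δ_E))^{1/(n-1)}` … Theorem 16.1 for the various `D = N_E^*/p_i`"),
in logarithmic, multiplied-out form and with the SHARP exponent: `P` a set of `n ≥ 2` primes,
`N = ∏_{p ∈ P} p`, `v ≥ 1` on `P`; if `∏_{p ∈ P, p ≠ q} v p < N^e` for every `q ∈ P` and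
`n·e ≤ (n-1)·x`, then `∏_{p ∈ P} v p < N^x` (each `log v p` is counted `n - 1` times).
[cite: PastenShimura2024, Corollary 16.2 (arXiv numbering), proof] -/
theorem prod_lt_rpow_of_forall_erase {P : Finset ℕ} (hP : ∀ p ∈ P, p.Prime) {v : ℕ → ℕ}
    (hv : ∀ p ∈ P, 0 < v p) {e x : ℝ} (h2 : 2 ≤ P.card)
    (hkey : (P.card : ℝ) * e ≤ ((P.card : ℝ) - 1) * x)
    (hq : ∀ q ∈ P, ((∏ p ∈ P.erase q, v p : ℕ) : ℝ) < ((∏ p ∈ P, p : ℕ) : ℝ) ^ e) :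
    ((∏ p ∈ P, v p : ℕ) : ℝ) < ((∏ p ∈ P, p : ℕ) : ℝ) ^ x := by
  have hNpos : (0 : ℝ) < ((∏ p ∈ P, p : ℕ) : ℝ) := by
    exact_mod_cast prod_pos fun p hp ↦ (hP p hp).pos
  have hN1 : (1 : ℝ) ≤ ((∏ p ∈ P, p : ℕ) : ℝ) := by
    exact_mod_cast Nat.one_le_iff_ne_zero.2 (prod_pos fun p hp ↦ (hP p hp).pos).ne'
  have hlogN : 0 ≤ Real.log ((∏ p ∈ P, p : ℕ) : ℝ) := Real.log_nonneg hN1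
  have hVpos : (0 : ℝ) < ((∏ p ∈ P, v p : ℕ) : ℝ) := by exact_mod_cast prod_pos fun p hp ↦ hv p hp
  have hlogV := log_cast_prod_eq_sum (s := P) fun p hp ↦ (hv p hp).ne'
  -- each hypothesis in logarithmic form
  have hq' : ∀ q ∈ P, ∑ p ∈ P.erase q, Real.log (v p : ℝ) <
      e * Real.log ((∏ p ∈ P, p : ℕ) : ℝ) := by
    intro q hqP
    have hlhs : (0 : ℝ) < ((∏ p ∈ P.erase q, v p : ℕ) : ℝ) := by
      exact_mod_cast prod_pos fun p hp ↦ hv p (mem_of_mem_erase hp)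
    have h := Real.log_lt_log hlhs (hq q hqP)
    rwa [log_cast_prod_eq_sum (s := P.erase q) fun p hp ↦ (hv p (mem_of_mem_erase hp)).ne',
      Real.log_rpow hNpos] at h
  -- sum over `q ∈ P`: `(n - 1) · log V < n · e · log N ≤ (n - 1) · x · log N`
  have hne : P.Nonempty := card_pos.1 (by omega)
  have hsum := sum_lt_sum_of_nonempty hne hq'
  rw [sum_sum_erase_eq, ← hlogV, sum_const, nsmul_eq_mul] at hsum
  have hn1 : (0 : ℝ) < (P.card : ℝ) - 1 := by
    have h2' : (2 : ℝ) ≤ P.card := by exact_mod_cast h2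
    linarith
  have hmain : Real.log ((∏ p ∈ P, v p : ℕ) : ℝ) < x * Real.log ((∏ p ∈ P, p : ℕ) : ℝ) := by
    refine lt_of_mul_lt_mul_left ?_ hn1.le
    calc ((P.card : ℝ) - 1) * Real.log ((∏ p ∈ P, v p : ℕ) : ℝ)
        < (P.card : ℝ) * (e * Real.log ((∏ p ∈ P, p : ℕ) : ℝ)) := hsum
      _ = ((P.card : ℝ) * e) * Real.log ((∏ p ∈ P, p : ℕ) : ℝ) := by ring
      _ ≤ (((P.card : ℝ) - 1) * x) * Real.log ((∏ p ∈ P, p : ℕ) : ℝ) :=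
          mul_le_mul_of_nonneg_right hkey hlogN
      _ = ((P.card : ℝ) - 1) * (x * Real.log ((∏ p ∈ P, p : ℕ) : ℝ)) := by ring
  rwa [← Real.log_rpow hNpos, Real.log_lt_log_iff hVpos (Real.rpow_pos_of_pos hNpos x)] at hmain

/-- For squarefree `N` and a prime factor `q` of `N` (the `D = N/p_i` of the proof of Corollary
16.2): `D = ∏_{p ∣ N, p ≠ q} p` satisfies `D · q = N`, `D ∣ N` and `primeFactors D = primeFactors N ∖ {q}`.
[cite: PastenShimura2024, Corollary 16.2 (arXiv numbering), proof] -/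
theorem erase_prod_admissible {N : ℕ} (hN : Squarefree N) {q : ℕ} (hq : q ∈ N.primeFactors) :
    (∏ p ∈ N.primeFactors.erase q, p) * q = N ∧ (∏ p ∈ N.primeFactors.erase q, p) ∣ N ∧
      (∏ p ∈ N.primeFactors.erase q, p).primeFactors = N.primeFactors.erase q := by
  have hprod : (∏ p ∈ N.primeFactors.erase q, p) * q = N := by
    rw [prod_erase_mul _ (fun p ↦ p) hq, Nat.prod_primeFactors_of_squarefree hN]
  exact ⟨hprod, Dvd.intro q hprod,
    Nat.primeFactors_prod fun p hp ↦ Nat.prime_of_mem_primeFactors (mem_of_mem_erase hp)⟩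

/-- **The boundary for `n ∈ {5, 7, 9, 11}` bad places from Theorem 16.1** (hypothesis `h161`:
Theorem 16.1 in the semi-stable case, `S = ∅`, for squarefree conductors `N ≥ N₀(ε)` and divisors
`1 < D ∣ N` with an even number of prime factors: `∏_{p∣D} v_p(Δ_E) < N^{11/3+ε}`; an explicit
hypothesis, NOT a fact of the tree).  For `m ∈ {2, 4, 6, 8}` there is `K` such that every semi-stable
`E/ℚ` with exactly `m + 3` bad places has `∏_{p∣N_E} v_p(Δ_E) < K · N_E^{8/3 + 11/m}`: Theorem 16.1
with `ε' = 1/150` for the `n = m + 3` divisors `D = N/p_i` and `prod_lt_rpow_of_forall_erase`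
(`(11/3 + 1/150)·n ≤ (n-1)·(8/3 + 11/m)` for these four `m`; for `m = 8` the margin is `1/100`);
conductors `< N₀` by the first display (`h112`).  These are the boundary cases `ε = 11/m` of the
printed Theorem 16.5 that its printed proof misses but the paper's Theorem 16.1 still covers.
[cite: PastenShimura2024, Theorem 16.1 and Corollary 16.2 (arXiv numbering), proof] -/
theorem boundary_of_thm_16_1 (h112 : pastenShimura2024_thm_1_12)
    (h161 : ∀ ε : ℝ, 0 < ε → ∃ N₀ : ℕ, ∀ (W : WeierstrassCurve ℚ) [W.IsElliptic],
      Squarefree (W.conductorNorm ℤ) → N₀ ≤ W.conductorNorm ℤ →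
        ∀ D : ℕ, 1 < D → D ∣ W.conductorNorm ℤ → Even D.primeFactors.card →
          ((∏ p ∈ D.primeFactors, (W.minimalDiscriminantNorm ℤ).factorization p : ℕ) : ℝ)
            < (W.conductorNorm ℤ : ℝ) ^ (11 / 3 + ε : ℝ))
    {m : ℕ} (hm0 : 0 < m) (hm8 : m ≤ 8) (hme : Even m) :
    ∃ K : ℝ, 0 < K ∧ ∀ (W : WeierstrassCurve ℚ) [W.IsElliptic],
      Squarefree (W.conductorNorm ℤ) → (W.conductorNorm ℤ).primeFactors.card = m + 3 →
        ((∏ p ∈ (W.conductorNorm ℤ).primeFactors,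
            (W.minimalDiscriminantNorm ℤ).factorization p : ℕ) : ℝ)
          < K * (W.conductorNorm ℤ : ℝ) ^ (8 / 3 + 11 / m : ℝ) := by
  obtain ⟨k, hk⟩ := hme
  -- the exponent inequality `(11/3 + 1/150)·(m+3) ≤ (m+2)·(8/3 + 11/m)` for `m ∈ {2, 4, 6, 8}`
  have hkey : ((m : ℝ) + 3) * (11 / 3 + 1 / 150) ≤ ((m : ℝ) + 3 - 1) * (8 / 3 + 11 / m) := by
    have hk4 : k ≤ 4 := by omega
    have hk1 : 1 ≤ k := by omega
    subst hk
    interval_cases k <;> norm_num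
  obtain ⟨N₀, hN₀⟩ := h161 (1 / 150) (by norm_num)
  obtain ⟨K₁, hK₁pos, hK₁⟩ := h112 1 one_pos
  have hKpos : (0 : ℝ) < max (K₁ * (N₀ : ℝ) ^ (11 / 2 + 1 : ℝ)) 1 := lt_max_of_lt_right one_pos
  refine ⟨max (K₁ * (N₀ : ℝ) ^ (11 / 2 + 1 : ℝ)) 1, hKpos, fun W _ hsq hcard ↦ ?_⟩
  -- Generalise the conductor and the minimal discriminant norm of `W` to plain naturals `N`, `Δ`.
  obtain ⟨N, hN⟩ : ∃ N : ℕ, W.conductorNorm ℤ = N := ⟨_, rfl⟩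
  obtain ⟨Δ, hΔ⟩ : ∃ Δ : ℕ, W.minimalDiscriminantNorm ℤ = Δ := ⟨_, rfl⟩
  have H161 := hN₀ W hsq
  have H112 := hK₁ W hsq
  rw [hN, hΔ] at H161 H112
  rw [hN] at hsq hcard
  rw [hN, hΔ]
  have hN0 : N ≠ 0 := hsq.ne_zero
  have hNpos : (0 : ℝ) < N := by exact_mod_cast Nat.pos_of_ne_zero hN0
  have hrpow_pos : 0 < (N : ℝ) ^ (8 / 3 + 11 / m : ℝ) := Real.rpow_pos_of_pos hNpos _
  have hrpow_one : 1 ≤ (N : ℝ) ^ (8 / 3 + 11 / m : ℝ) :=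
    Real.one_le_rpow (by exact_mod_cast Nat.pos_of_ne_zero hN0) (by positivity)
  by_cases hsmall : N < N₀
  · -- Small conductor: the first display with exponent `11/2 + 1`, a constant.
    calc ((∏ p ∈ N.primeFactors, Δ.factorization p : ℕ) : ℝ)
        < K₁ * (N : ℝ) ^ (11 / 2 + 1 : ℝ) := H112
      _ ≤ K₁ * (N₀ : ℝ) ^ (11 / 2 + 1 : ℝ) := mul_le_mul_of_nonneg_left
          (Real.rpow_le_rpow hNpos.le (by exact_mod_cast hsmall.le) (by norm_num)) hK₁pos.le
      _ ≤ max (K₁ * (N₀ : ℝ) ^ (11 / 2 + 1 : ℝ)) 1 := le_max_left _ _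
      _ ≤ max (K₁ * (N₀ : ℝ) ^ (11 / 2 + 1 : ℝ)) 1 * (N : ℝ) ^ (8 / 3 + 11 / m : ℝ) :=
          le_mul_of_one_le_right hKpos.le hrpow_one
  · -- Large conductor: Theorem 16.1 for the `n` divisors `D = N / q`, then `(n-1)`-st roots.
    rw [not_lt] at hsmall
    by_cases hV0 : ∏ p ∈ N.primeFactors, Δ.factorization p = 0
    · rw [hV0, Nat.cast_zero]
      exact mul_pos hKpos hrpow_pos
    have hvpos : ∀ p ∈ N.primeFactors, 0 < Δ.factorization p := fun p hp ↦
      Nat.pos_of_ne_zero fun h0 ↦ hV0 (prod_eq_zero hp h0)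
    have hPprime : ∀ p ∈ N.primeFactors, p.Prime := fun p hp ↦ Nat.prime_of_mem_primeFactors hp
    have hNprod : ∏ p ∈ N.primeFactors, p = N := Nat.prod_primeFactors_of_squarefree hsq
    have h2 : 2 ≤ N.primeFactors.card := by omega
    have hkey' : (N.primeFactors.card : ℝ) * (11 / 3 + 1 / 150) ≤
        ((N.primeFactors.card : ℝ) - 1) * (8 / 3 + 11 / m) := by
      rw [hcard]; push_cast; exact hkey
    have key := prod_lt_rpow_of_forall_erase hPprime hvpos h2 hkey' ?_
    · rw [hNprod] at key
      exact key.trans_le (le_mul_of_one_le_left hrpow_pos.le (le_max_right _ _))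
    · intro q hq
      obtain ⟨-, hdvd, hpf⟩ := erase_prod_admissible hsq hq
      have h1D : 1 < ∏ p ∈ N.primeFactors.erase q, p := by
        refine Nat.one_lt_iff_ne_zero_and_ne_one.2
          ⟨(prod_pos fun p hp ↦ (hPprime p (mem_of_mem_erase hp)).pos).ne', fun h1 ↦ ?_⟩
        have h0 : (N.primeFactors.erase q).card = 0 := by
          rw [← hpf, h1, Nat.primeFactors_one, card_empty]
        rw [card_erase_of_mem hq] at h0
        omega
      have hevenD : Even (∏ p ∈ N.primeFactors.erase q, p).primeFactors.card := by
        rw [hpf, card_erase_of_mem hq, hcard]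
        exact ⟨k + 1, by omega⟩
      have h := H161 hsmall _ h1D hdvd hevenD
      rw [hpf] at h
      rwa [hNprod]

end Boundary

/-- **The residue, given every theorem-level input of the paper.**  Assume Corollary 16.2
(`pasten_cor_16_2`), Mestre–Oesterlé for prime conductor (`mestreOesterle_factorization_le_five`),
Theorem 16.4 (i) (`h164`) and Theorem 16.1 (`h161`, semi-stable case) — the last two as explicit
hypotheses in the shapes above.  Then the verbatim fact `pasten_thm_1_12` holds if and only if the
boundary family holds for every EVEN `m ≥ 10`: "there is `K > 0` such that every semi-stable `E/ℚ`
with exactly `m + 3` places of bad reduction has `∏_{p∣N_E} v_p(Δ_E) < K · N_E^{8/3 + 11/m}`".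
(`←`: the corrected statement by `pasten_thm_1_12_strict_of_thm_16_4`; `B(m)` for `m` odd by
`prod_lt_of_thm_16_4_of_even`, for `m ∈ {2,4,6,8}` by `boundary_of_thm_16_1`, for `m` even `≥ 10`
by hypothesis; assemble with `pasten_thm_1_12_iff_strict_and_boundary`.)  This is the precise
sense in which the printed "at least `3 + 11/ε`" over-claims: no combination of the source's
bounds (Theorems 16.1, 16.4 (i), the first display) yields `B(m)` for `m` even `≥ 10` (module
docstring). [cite: PastenShimura2024, Theorem 16.5 (arXiv numbering) and its proof,
p. 50; Theorem 16.1; Corollary 16.2] -/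
theorem pasten_thm_1_12_iff_boundary_even_ten_le (h₁ : pasten_cor_16_2)
    (h₂ : mestreOesterle_factorization_le_five)
    (h164 : ∀ ε : ℝ, 0 < ε → ∃ N₀ : ℕ, ∀ (W : WeierstrassCurve ℚ) [W.IsElliptic],
      Squarefree (W.conductorNorm ℤ) → N₀ ≤ W.conductorNorm ℤ →
        ∀ D : ℕ, 1 < D → D ∣ W.conductorNorm ℤ → Even D.primeFactors.card →
          ¬ (W.conductorNorm ℤ / D).Prime →
            ((∏ p ∈ D.primeFactors, (W.minimalDiscriminantNorm ℤ).factorization p : ℕ) : ℝ)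
              < (W.conductorNorm ℤ : ℝ) ^ (8 / 3 + ε : ℝ) * ((W.conductorNorm ℤ / D : ℕ) : ℝ))
    (h161 : ∀ ε : ℝ, 0 < ε → ∃ N₀ : ℕ, ∀ (W : WeierstrassCurve ℚ) [W.IsElliptic],
      Squarefree (W.conductorNorm ℤ) → N₀ ≤ W.conductorNorm ℤ →
        ∀ D : ℕ, 1 < D → D ∣ W.conductorNorm ℤ → Even D.primeFactors.card →
          ((∏ p ∈ D.primeFactors, (W.minimalDiscriminantNorm ℤ).factorization p : ℕ) : ℝ)
            < (W.conductorNorm ℤ : ℝ) ^ (11 / 3 + ε : ℝ)) :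
    pasten_thm_1_12 ↔
      ∀ m : ℕ, Even m → 10 ≤ m → ∃ K : ℝ, 0 < K ∧ ∀ (W : WeierstrassCurve ℚ) [W.IsElliptic],
        W.IsSemistable ℤ → (W.conductorNorm ℤ).primeFactors.card = m + 3 →
          ((∏ p ∈ (W.conductorNorm ℤ).primeFactors,
              (W.minimalDiscriminantNorm ℤ).factorization p : ℕ) : ℝ)
            < K * (W.conductorNorm ℤ : ℝ) ^ (8 / 3 + 11 / m : ℝ) := by
  have h112 : pastenShimura2024_thm_1_12 :=
    pasten_valuationProduct_semistable_iff_pastenShimura2024_thm_1_12.mp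
      (pasten_valuationProduct_semistable_of_cor_16_2 h₁ h₂)
  constructor
  · intro h m _ hm
    exact (pasten_thm_1_12_iff_strict_and_boundary.mp h).2 m (by omega)
  · intro hres
    refine pasten_thm_1_12_iff_strict_and_boundary.mpr
      ⟨pasten_thm_1_12_strict_of_thm_16_4 h₁ h₂ h164, fun m hm ↦ ?_⟩
    rcases Nat.even_or_odd m with hme | hmo
    · rcases le_or_gt m 8 with hm8 | hm8
      · obtain ⟨K, hK, hKW⟩ := boundary_of_thm_16_1 h112 h161 hm hm8 hme
        exact ⟨K, hK, fun W _ hW hcard ↦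
          hKW W ((W.isSemistable_iff_squarefree_conductorNorm).mp hW) hcard⟩
      · have h10 : 10 ≤ m := by obtain ⟨k, hk⟩ := hme; omega
        exact hres m hme h10
    · -- `m` odd: `n = m + 3` is even, Theorem 16.4 (i) with `D = N` at `ε = 11/m`.
      have hε : (0 : ℝ) < 11 / m := div_pos (by norm_num) (by exact_mod_cast hm)
      obtain ⟨K, hK, hKW⟩ := prod_lt_of_thm_16_4_of_even h112 h164 (11 / m) hε
      refine ⟨K, hK, fun W _ hW hcard ↦
        hKW W ((W.isSemistable_iff_squarefree_conductorNorm).mp hW) ?_⟩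
      rw [hcard]
      obtain ⟨k, hk⟩ := hmo
      exact ⟨k + 2, by omega⟩

end Literature.NumberTheory.EllipticCurves

end
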